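import Literature.NumberTheory.Automorphic.GlobalHeckeTheoryGL2OfCenterInvariant
import Literature.NumberTheory.Automorphic.AutomorphicRepsGLCuspidalUnitaryHolds
import Literature.NumberTheory.Automorphic.CuspFormsBoundedHC
import Literature.NumberTheory.Automorphic.AutomorphicRepsGLCuspidalL2
import HarnessLib

/-!
# The global Hecke theory of `GL₂` from its case for CLEAN `A_G`-invariant cuspidal data
# (Borel–Jacquet 1979, 4.6: complete reducibility of cusp forms; Jacquet–Langlands 1970, §§10–11)

Topic `Literature/NumberTheory/Automorphic`; proof file (theorems only: no definition, no named
fact, no instance), continuing `GlobalHeckeTheoryGL2OfCenterInvariant`.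

Jacquet–Langlands prove their Thm. 11.1 for an irreducible constituent `π` of the space `𝒜₀` of
cusp forms, i.e. (cusp forms being completely reducible, Gelfand–Piatetski-Shapiro; Borel–Jacquet
1979, 4.6) for an irreducible INVARIANT SUBSPACE `V ≤ 𝒜₀` of genuine cusp forms — in the language
of the tree's Borel–Jacquet data `π = W / W'`, for CLEAN data `W' = ⊥`.  This file performs that
reduction for the analytic package `(an)` of the global Hecke theory of `GL₂`
(`JacquetLanglands1970_standardLTheoryGL2_of_globalHeckeTheory`):

* `CuspidalAutomorphicRepData.exists_clean_hasLocalComponentAt`: a cuspidal Borel–Jacquet datum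
  `π = W / W'` of `GL_n(𝔸_K)` with `A_G`-invariant cusp forms has a clean model `π₀ = W₀ / ⊥`,
  `W = W' ⊕ W₀` (the stable complement `W ∩ W'^⊥` of `AutomorphicRepsGLCuspidalUnitary`:
  `exists_stable_compl_of_le_sup_l2Orth` with the discharged `cuspidal_bounded_holds`,
  `stable_cuspidal_le_sup_l2Orth_holds`), whose local components — and those of `π₀^τ` — are local
  components of `π` — resp. `π^τ` (`AutomorphicRepData.hasLocalComponentAt_of_model` of
  `CuspidalEigenModelLocalComponent` along the inclusion `W₀ ↪ W`, which detects `W'` since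
  `W₀ ∩ W' = 0`);
* `globalHeckeTheoryGL2_an_of_clean`: **if `(an)` holds for every cuspidal datum of `GL₂(𝔸_F)`
  with `W' = ⊥` and `A_G`-invariant cusp forms, it holds for every cuspidal datum**
  (`globalHeckeTheoryGL2_an_of_centerInvariant` and the above);
* corollaries for the named facts `JacquetLanglands1970_standardLTheoryGL2`,
  `JacquetLanglands1970_twistedHeckeTheoryGL2`,
  `frobSatakeCompatibleAt_of_isPiOfArtinRep_of_isUnramifiedAt` from `(an)`, resp. from the
  integral-representation package `(IR)` of `StandardLTheoryGL2AnalyticAssembly`, for clean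
  `A_G`-invariant cuspidal data only (`…_of_globalHeckeTheory_clean`,
  `…_of_integralRepresentation_clean`).

## References

* A. Borel, H. Jacquet, *Automorphic forms and automorphic representations*, Proc. Sympos. Pure
  Math. 33.1 (1979), 4.4–4.6, 5.7. [BorelJacquetCorvallis1979]
* H. Jacquet, R. P. Langlands, *Automorphic Forms on GL(2)*, LNM 114 (1970), §10 (Prop. 10.9:
  `𝒜₀` is a direct sum of irreducibles) and Thm. 11.1, pp. 168–173. [JacquetLanglands1970]
* A. W. Knapp, D. A. Vogan, *Cohomological induction and unitary representations* (1995), Ch. IX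
  §1. [KnappVogan1995]
-/

noncomputable section

open scoped MatrixGroups NNReal Classical
open MeasureTheory NumberField IsDedekindDomain Polynomial Filter Complex

namespace Literature.NumberTheory.Automorphic

/-! ### Part 1: a clean model with the same local components -/

section Clean

variable {n : ℕ} {K : Type} [Field K] [NumberField K] {hcpt : isCompact_glFiniteIntegralLevel n K}

local notation "τ𝔸[" g "]" => weylLong n (AdeleRing (𝓞 K) K) *
  Literature.NumberTheory.GaloisRepresentations.glTransposeInv (Fin n) (AdeleRing (𝓞 K) K) g *
    weylLong n (AdeleRing (𝓞 K) K)
set_option quotPrecheck false in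
local notation "τ𝔸⋆" => LinearMap.funLeft ℂ ℂ (m := (AdelicGroupData.gl n K).Adelic)
  (n := (AdelicGroupData.gl n K).Adelic) fun g => τ𝔸[g]

set_option maxHeartbeats 800000 in
/-- **A clean model with the same local components.** A cuspidal Borel–Jacquet datum `π = W / W'`
of `GL_n(𝔸_K)` whose cusp forms are `A_G`-invariant has a clean cuspidal model `π₀ = W₀ / ⊥` with
`W₀ ≤ W` — a stable complement of `W'` in `W` (`W' ⊓ W₀ = ⊥`, `W' ⊔ W₀ = W`: complete
reducibility of `A_G`-invariant cusp forms, `AutomorphicRepsGL.exists_stable_compl_of_le_sup_l2Orth`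
with `cuspidal_bounded_holds` and `stable_cuspidal_le_sup_l2Orth_holds`; Borel–Jacquet 1979, 4.6,
Jacquet–Langlands 1970, Prop. 10.9) — such that every local component of `π₀` at a finite place is
a local component of `π`, and every local component of `π₀^τ` one of `π^τ`
(`AutomorphicRepData.hasLocalComponentAt_of_model` along `W₀ ↪ W`, resp. `W₀ ∘ τ ↪ W ∘ τ`, which
detect `W'` as `W₀ ∩ W' = 0`). [cite: BorelJacquetCorvallis1979, §4.6 and 5.7]
[cite: JacquetLanglands1970, Prop. 10.9 and Thm. 11.1] -/
theorem CuspidalAutomorphicRepData.exists_clean_hasLocalComponentAt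
    (π : CuspidalAutomorphicRepData n K hcpt)
    (hAG : ∀ φ ∈ π.1.W, ∀ (t : ℝ≥0ˣ) (g : (AdelicGroupData.gl n K).Adelic),
      φ ((show (AdelicGroupData.gl n K).Adelic from posRealScalar n K t) * g) = φ g) :
    ∃ π₀ : CuspidalAutomorphicRepData n K hcpt, π₀.1.W' = ⊥ ∧ π₀.1.W ≤ π.1.W ∧
      (∀ (v : HeightOneSpectrum (𝓞 K)) (V : Type) [AddCommGroup V] [Module ℂ V]
        (ρ : Representation ℂ (GL (Fin n) (v.adicCompletion K)) V),
        π₀.1.HasLocalComponentAt v ρ → π.1.HasLocalComponentAt v ρ) ∧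
      (∀ (v : HeightOneSpectrum (𝓞 K)) (V : Type) [AddCommGroup V] [Module ℂ V]
        (ρ : Representation ℂ (GL (Fin n) (v.adicCompletion K)) V),
        π₀.transposeInv.1.HasLocalComponentAt v ρ → π.transposeInv.1.HasLocalComponentAt v ρ) := by
  classical
  -- an automorphic measure, and `A_G`-invariance phrased on `center'`
  obtain ⟨μ, hμ⟩ : AdelicGroupData.exists_isAutomorphicMeasure_gl n K :=
    AdelicGroupData.exists_isAutomorphicMeasure_gl_holds n K
  haveI := hμ
  have hAG' : ∀ φ ∈ π.1.W, ∀ z ∈ (AdelicGroupData.gl n K).center', ∀ g, φ (z * g) = φ g := by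
    intro φ hφ z hz g
    obtain ⟨t, rfl⟩ := MonoidHom.mem_range.1 hz
    exact hAG φ hφ t g
  -- the stable complement `W₀` of `W'` in `W`
  obtain ⟨W₀, hW₀st, hW₀W, hinf, hsup⟩ :=
    AutomorphicRepsGL.exists_stable_compl_of_le_sup_l2Orth (μ := μ)
      AutomorphicRepsGL.cuspidal_bounded_holds AutomorphicRepsGL.stable_cuspidal_le_sup_l2Orth_holds
      π.1.stable π.2 hAG' π.1.stable' π.1.lt.le
  have hlt : (⊥ : Submodule ℂ ((AdelicGroupData.gl n K).Adelic → ℂ)) < W₀ := by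
    refine bot_lt_iff_ne_bot.2 fun h0 => ?_
    rw [h0, sup_bot_eq] at hsup
    exact π.1.lt.ne hsup
  have hmeet : ∀ x, x ∈ π.1.W' → x ∈ W₀ → x = 0 := fun x hx hx' => by
    have h : x ∈ π.1.W' ⊓ W₀ := ⟨hx, hx'⟩
    rwa [hinf, Submodule.mem_bot] at h
  have hirr : ∀ W'' : Submodule ℂ ((AdelicGroupData.gl n K).Adelic → ℂ), ⊥ ≤ W'' → W'' ≤ W₀ →
      IsStableSubmodule (AutomorphyDatum.gl n K hcpt) W'' → W'' = ⊥ ∨ W'' = W₀ := by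
    intro W'' _ hW''W₀ hW''st
    rcases π.1.irreducible (π.1.W' ⊔ W'') le_sup_left (sup_le π.1.lt.le (hW''W₀.trans hW₀W))
        (π.1.stable'.sup hW''st) with h | h
    · left
      refine eq_bot_iff.2 fun x hx => ?_
      have hxW' : x ∈ π.1.W' := by
        have hx' : x ∈ π.1.W' ⊔ W'' := Submodule.mem_sup_right hx
        rwa [h] at hx'
      rw [Submodule.mem_bot]
      exact hmeet x hxW' (hW''W₀ hx)
    · right
      refine le_antisymm hW''W₀ fun x hx => ?_
      have hxW : x ∈ π.1.W' ⊔ W'' := by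
        rw [h]
        exact hW₀W hx
      obtain ⟨a, ha, b, hb, hab⟩ := Submodule.mem_sup.1 hxW
      have haW₀ : a ∈ W₀ := by
        have ha' : a = x - b := by rw [← hab]; abel
        rw [ha']
        exact sub_mem hx (hW''W₀ hb)
      have ha0 : a = 0 := hmeet a ha haW₀
      rw [← hab, ha0, zero_add]
      exact hb
  let π₀ : CuspidalAutomorphicRepData n K hcpt :=
    ⟨{ W := W₀, W' := ⊥, lt := hlt, stable := hW₀st, stable' := isStableSubmodule_bot _,
       irreducible := hirr }, hW₀W.trans π.2⟩
  -- `W₀ ↪ W` detects `W'`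
  have hkey : ∀ φ ∈ W₀, φ ∈ (⊥ : Submodule ℂ ((AdelicGroupData.gl n K).Adelic → ℂ)) ↔ φ ∈ π.1.W' :=
    fun φ hφ => ⟨fun h0 => by rw [(Submodule.mem_bot ℂ).1 h0]; exact zero_mem _,
      fun hW' => (Submodule.mem_bot ℂ).2 (hmeet φ hW' hφ)⟩
  -- `τ` and right translations
  have hτR : ∀ (h : (AdelicGroupData.gl n K).Adelic) (φ : (AdelicGroupData.gl n K).Adelic → ℂ),
      τ𝔸⋆ (rightTranslation (AdelicGroupData.gl n K) h φ) =
        rightTranslation (AdelicGroupData.gl n K) (τ𝔸[h]) (τ𝔸⋆ φ) := fun h φ => by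
    rw [rightTranslation_funLeft_weylLong_mul_glTransposeInv_mul_weylLong,
      weylLong_mul_glTransposeInv_mul_weylLong_involutive]
  have hτfin : ∀ h ∈ (AutomorphyDatum.gl n K hcpt).finiteAdelic,
      (τ𝔸[h]) ∈ (AutomorphyDatum.gl n K hcpt).finiteAdelic := fun h hh =>
    weylLong_mul_glTransposeInv_mul_weylLong_mem_range_ofFinite hh
  have hmemτ : ∀ (W₁ : Submodule ℂ ((AdelicGroupData.gl n K).Adelic → ℂ)) (ψ : (AdelicGroupData.gl n K).Adelic → ℂ),
      ψ ∈ W₁.map τ𝔸⋆ ↔ τ𝔸⋆ ψ ∈ W₁ :=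
    mem_map_funLeft_weylLong_mul_glTransposeInv_mul_weylLong_iff
  have hττ : ∀ ψ : (AdelicGroupData.gl n K).Adelic → ℂ, τ𝔸⋆ (τ𝔸⋆ ψ) = ψ :=
    funLeft_weylLong_mul_glTransposeInv_mul_weylLong_involutive
  -- abstract the involution `τ⋆` as an opaque linear map `T`
  obtain ⟨T, hTR, hTT, hTmem, hTW, hTW'⟩ :
      ∃ T : ((AdelicGroupData.gl n K).Adelic → ℂ) →ₗ[ℂ] ((AdelicGroupData.gl n K).Adelic → ℂ),
        (∀ h ∈ (AutomorphyDatum.gl n K hcpt).finiteAdelic,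
          ∃ h' ∈ (AutomorphyDatum.gl n K hcpt).finiteAdelic,
            (∀ φ, T (rightTranslation (AdelicGroupData.gl n K) h φ) =
              rightTranslation (AdelicGroupData.gl n K) h' (T φ))) ∧
        (∀ ψ, T (T ψ) = ψ) ∧
        (∀ (W₁ : Submodule ℂ ((AdelicGroupData.gl n K).Adelic → ℂ)) ψ, ψ ∈ W₁.map T ↔ T ψ ∈ W₁) ∧
        (∀ σ : AutomorphicRepData (AutomorphyDatum.gl n K hcpt), σ.transposeInv.W = σ.W.map T) ∧
        (∀ σ : AutomorphicRepData (AutomorphyDatum.gl n K hcpt), σ.transposeInv.W' = σ.W'.map T) :=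
    ⟨τ𝔸⋆, fun h hh => ⟨τ𝔸[h], hτfin h hh, fun φ => hτR h φ⟩, hττ, hmemτ, fun σ => rfl, fun σ => rfl⟩
  -- the `τ`-side model `W₀ ∘ τ ↪ W ∘ τ`
  have hMBτ : W₀.map T ≤ π.1.transposeInv.W := by
    rw [hTW]
    exact Submodule.map_mono hW₀W
  have hMstτ : ∀ h ∈ (AutomorphyDatum.gl n K hcpt).finiteAdelic, ∀ φ ∈ W₀.map T,
      rightTranslation (AdelicGroupData.gl n K) h φ ∈ W₀.map T := fun h hh φ hφ => by
    obtain ⟨h', hh', e1⟩ := hTR h hh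
    rw [hTmem] at hφ ⊢
    rw [e1]
    exact hW₀st.finite_stable h' hh' hφ
  have hAWτ : ∀ ψ, ψ ∈ π₀.1.transposeInv.W ↔ ∃ φ ∈ W₀.map T, φ = ψ := fun ψ => by
    rw [hTW]
    exact ⟨fun h => ⟨ψ, h, rfl⟩, fun ⟨φ, hφ, e⟩ => e ▸ hφ⟩
  have hkeyτ : ∀ φ ∈ W₀.map T, φ ∈ π₀.1.transposeInv.W' ↔ φ ∈ π.1.transposeInv.W' := fun φ hφ => by
    rw [hTW', hTW', hTmem, hTmem]
    rw [hTmem] at hφ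
    change T φ ∈ (⊥ : Submodule ℂ ((AdelicGroupData.gl n K).Adelic → ℂ)) ↔ T φ ∈ π.1.W'
    exact hkey _ hφ
  refine ⟨π₀, rfl, hW₀W, fun v V _ _ ρ hρ => ?_, fun v V _ _ ρ hρ => ?_⟩
  · exact AutomorphicRepData.hasLocalComponentAt_of_model (A := π₀.1) (B := π.1) W₀ hW₀W
      (fun h hh φ hφ => hW₀st.finite_stable h hh hφ) (fun φ => φ) (fun _ _ _ _ => rfl)
      (fun _ _ => rfl) (fun _ _ _ _ => rfl)
      (fun ψ => ⟨fun h => ⟨ψ, h, rfl⟩, fun ⟨φ, hφ, e⟩ => e ▸ hφ⟩) hkey hρ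
  · exact AutomorphicRepData.hasLocalComponentAt_of_model (A := π₀.1.transposeInv)
      (B := π.1.transposeInv) (W₀.map T) hMBτ hMstτ (fun φ => φ) (fun _ _ _ _ => rfl)
      (fun _ _ => rfl) (fun _ _ _ _ => rfl) hAWτ hkeyτ hρ

end Clean

/-! ### Part 2: `(an)` for clean `A_G`-invariant cuspidal data implies `(an)` for all -/

section Main

/-- **Jacquet–Langlands' setting suffices: the analytic package `(an)` of the global Hecke theory
of `GL₂` for all cuspidal `π = W / W'` follows from its case for CLEAN data (`W' = ⊥`: an
irreducible invariant space `W` of genuine cusp forms) with `A_G`-invariant cusp forms**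
(`globalHeckeTheoryGL2_an_of_centerInvariant`, then
`CuspidalAutomorphicRepData.exists_clean_hasLocalComponentAt`: the clean model inherits the local
hypotheses of `π` and of `π^τ`). [cite: JacquetLanglands1970, Prop. 10.9 and Thm. 11.1, pp. 168–173]
[cite: BorelJacquetCorvallis1979, §4.6 and 5.7] -/
theorem globalHeckeTheoryGL2_an_of_clean
    (H : ∀ {F : Type} [Field F] [NumberField F] (hcpt : isCompact_glFiniteIntegralLevel 2 F)
      (π : CuspidalAutomorphicRepData 2 F hcpt) (P P' : HeightOneSpectrum (𝓞 F) → ℂ[X]),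
      π.1.W' = ⊥ →
      (∀ φ ∈ π.1.W, ∀ (t : ℝ≥0ˣ) (g : (AdelicGroupData.gl 2 F).Adelic),
        φ ((show (AdelicGroupData.gl 2 F).Adelic from posRealScalar 2 F t) * g) = φ g) →
      (∀ (u : HeightOneSpectrum (𝓞 F)) (πu : SmoothIrrep (GL (Fin 2) (u.adicCompletion F))),
        π.1.HasLocalComponentAt u πu.ρ →
        ∀ (ψ : AddChar (u.adicCompletion F) Circle), ψ.IsContinuousNontrivial →
        ∀ [MeasurableSpace (u.adicCompletion F)] [BorelSpace (u.adicCompletion F)]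
          [MeasurableSpace (GL (Fin 1) (u.adicCompletion F) ⧸ upperUnitriangular (Fin 1) (u.adicCompletion F))]
          [BorelSpace (GL (Fin 1) (u.adicCompletion F) ⧸ upperUnitriangular (Fin 1) (u.adicCompletion F))]
          (ν : Measure (GL (Fin 1) (u.adicCompletion F) ⧸ upperUnitriangular (Fin 1) (u.adicCompletion F)))
          [SMulInvariantMeasure (GL (Fin 1) (u.adicCompletion F))
            (GL (Fin 1) (u.adicCompletion F) ⧸ upperUnitriangular (Fin 1) (u.adicCompletion F)) ν]
          [IsFiniteMeasureOnCompacts ν] [ν.IsOpenPosMeasure],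
          HasRSLFactor Nat.one_lt_two πu.ρ
            (Representation.trivial ℂ (GL (Fin 1) (u.adicCompletion F)) ℂ) ψ ν (P u)) →
      (∀ (u : HeightOneSpectrum (𝓞 F)) (πu : SmoothIrrep (GL (Fin 2) (u.adicCompletion F))),
        π.transposeInv.1.HasLocalComponentAt u πu.ρ →
        ∀ (ψ : AddChar (u.adicCompletion F) Circle), ψ.IsContinuousNontrivial →
        ∀ [MeasurableSpace (u.adicCompletion F)] [BorelSpace (u.adicCompletion F)]
          [MeasurableSpace (GL (Fin 1) (u.adicCompletion F) ⧸ upperUnitriangular (Fin 1) (u.adicCompletion F))]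
          [BorelSpace (GL (Fin 1) (u.adicCompletion F) ⧸ upperUnitriangular (Fin 1) (u.adicCompletion F))]
          (ν : Measure (GL (Fin 1) (u.adicCompletion F) ⧸ upperUnitriangular (Fin 1) (u.adicCompletion F)))
          [SMulInvariantMeasure (GL (Fin 1) (u.adicCompletion F))
            (GL (Fin 1) (u.adicCompletion F) ⧸ upperUnitriangular (Fin 1) (u.adicCompletion F)) ν]
          [IsFiniteMeasureOnCompacts ν] [ν.IsOpenPosMeasure],
          HasRSLFactor Nat.one_lt_two πu.ρ
            (Representation.trivial ℂ (GL (Fin 1) (u.adicCompletion F)) ℂ) ψ ν (P' u)) →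
      ∃ (Λ Λ' Γ Γ' ε : ℂ → ℂ) (c : ℝ),
        Meromorphic Λ ∧ Meromorphic Λ' ∧ Differentiable ℂ Γ ∧ Differentiable ℂ Γ' ∧
        (∃ Y : Set ℝ, Y.Finite ∧ ∀ s, Γ s = 0 → s.im ∈ Y) ∧
        (∃ Y : Set ℝ, Y.Finite ∧ ∀ s, Γ' s = 0 → s.im ∈ Y) ∧
        Continuous ε ∧ (∀ s, ε s ≠ 0) ∧ 1 ≤ c ∧
        (∀ s : ℂ, c < s.re →
          (Multipliable fun u : HeightOneSpectrum (𝓞 F) =>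
              ((P u).eval ((u.residueCard : ℂ) ^ (-s)))⁻¹) ∧
            (∀ u, (P u).eval ((u.residueCard : ℂ) ^ (-s)) ≠ 0) ∧
            Λ s * Γ s =
              ∏' u : HeightOneSpectrum (𝓞 F), ((P u).eval ((u.residueCard : ℂ) ^ (-s)))⁻¹) ∧
        (∀ s : ℂ, c < s.re →
          (Multipliable fun u : HeightOneSpectrum (𝓞 F) =>
              ((P' u).eval ((u.residueCard : ℂ) ^ (-s)))⁻¹) ∧
            (∀ u, (P' u).eval ((u.residueCard : ℂ) ^ (-s)) ≠ 0) ∧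
            Λ' s * Γ' s =
              ∏' u : HeightOneSpectrum (𝓞 F), ((P' u).eval ((u.residueCard : ℂ) ^ (-s)))⁻¹) ∧
        (∀ s, Λ s = ε s * Λ' (1 - s)))
    {F : Type} [Field F] [NumberField F] (hcpt : isCompact_glFiniteIntegralLevel 2 F)
    (π : CuspidalAutomorphicRepData 2 F hcpt) (P P' : HeightOneSpectrum (𝓞 F) → ℂ[X])
    (hP : ∀ (u : HeightOneSpectrum (𝓞 F)) (πu : SmoothIrrep (GL (Fin 2) (u.adicCompletion F))),
      π.1.HasLocalComponentAt u πu.ρ →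
      ∀ (ψ : AddChar (u.adicCompletion F) Circle), ψ.IsContinuousNontrivial →
      ∀ [MeasurableSpace (u.adicCompletion F)] [BorelSpace (u.adicCompletion F)]
        [MeasurableSpace (GL (Fin 1) (u.adicCompletion F) ⧸ upperUnitriangular (Fin 1) (u.adicCompletion F))]
        [BorelSpace (GL (Fin 1) (u.adicCompletion F) ⧸ upperUnitriangular (Fin 1) (u.adicCompletion F))]
        (ν : Measure (GL (Fin 1) (u.adicCompletion F) ⧸ upperUnitriangular (Fin 1) (u.adicCompletion F)))
        [SMulInvariantMeasure (GL (Fin 1) (u.adicCompletion F))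
          (GL (Fin 1) (u.adicCompletion F) ⧸ upperUnitriangular (Fin 1) (u.adicCompletion F)) ν]
        [IsFiniteMeasureOnCompacts ν] [ν.IsOpenPosMeasure],
        HasRSLFactor Nat.one_lt_two πu.ρ
          (Representation.trivial ℂ (GL (Fin 1) (u.adicCompletion F)) ℂ) ψ ν (P u))
    (hP' : ∀ (u : HeightOneSpectrum (𝓞 F)) (πu : SmoothIrrep (GL (Fin 2) (u.adicCompletion F))),
      π.transposeInv.1.HasLocalComponentAt u πu.ρ →
      ∀ (ψ : AddChar (u.adicCompletion F) Circle), ψ.IsContinuousNontrivial →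
      ∀ [MeasurableSpace (u.adicCompletion F)] [BorelSpace (u.adicCompletion F)]
        [MeasurableSpace (GL (Fin 1) (u.adicCompletion F) ⧸ upperUnitriangular (Fin 1) (u.adicCompletion F))]
        [BorelSpace (GL (Fin 1) (u.adicCompletion F) ⧸ upperUnitriangular (Fin 1) (u.adicCompletion F))]
        (ν : Measure (GL (Fin 1) (u.adicCompletion F) ⧸ upperUnitriangular (Fin 1) (u.adicCompletion F)))
        [SMulInvariantMeasure (GL (Fin 1) (u.adicCompletion F))
          (GL (Fin 1) (u.adicCompletion F) ⧸ upperUnitriangular (Fin 1) (u.adicCompletion F)) ν]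
        [IsFiniteMeasureOnCompacts ν] [ν.IsOpenPosMeasure],
        HasRSLFactor Nat.one_lt_two πu.ρ
          (Representation.trivial ℂ (GL (Fin 1) (u.adicCompletion F)) ℂ) ψ ν (P' u)) :
    ∃ (Λ Λ' Γ Γ' ε : ℂ → ℂ) (c : ℝ),
      Meromorphic Λ ∧ Meromorphic Λ' ∧ Differentiable ℂ Γ ∧ Differentiable ℂ Γ' ∧
      (∃ Y : Set ℝ, Y.Finite ∧ ∀ s, Γ s = 0 → s.im ∈ Y) ∧
      (∃ Y : Set ℝ, Y.Finite ∧ ∀ s, Γ' s = 0 → s.im ∈ Y) ∧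
      Continuous ε ∧ (∀ s, ε s ≠ 0) ∧ 1 ≤ c ∧
      (∀ s : ℂ, c < s.re →
        (Multipliable fun u : HeightOneSpectrum (𝓞 F) =>
            ((P u).eval ((u.residueCard : ℂ) ^ (-s)))⁻¹) ∧
          (∀ u, (P u).eval ((u.residueCard : ℂ) ^ (-s)) ≠ 0) ∧
          Λ s * Γ s =
            ∏' u : HeightOneSpectrum (𝓞 F), ((P u).eval ((u.residueCard : ℂ) ^ (-s)))⁻¹) ∧
      (∀ s : ℂ, c < s.re →
        (Multipliable fun u : HeightOneSpectrum (𝓞 F) =>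
            ((P' u).eval ((u.residueCard : ℂ) ^ (-s)))⁻¹) ∧
          (∀ u, (P' u).eval ((u.residueCard : ℂ) ^ (-s)) ≠ 0) ∧
          Λ' s * Γ' s =
            ∏' u : HeightOneSpectrum (𝓞 F), ((P' u).eval ((u.residueCard : ℂ) ^ (-s)))⁻¹) ∧
      (∀ s, Λ s = ε s * Λ' (1 - s)) := by
  refine globalHeckeTheoryGL2_an_of_centerInvariant ?_ hcpt π P P' hP hP'
  intro F _ _ hcpt π P P' hinv hP hP'
  obtain ⟨π₀, hbot, hW₀W, hloc, hlocτ⟩ := π.exists_clean_hasLocalComponentAt hinv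
  exact H hcpt π₀ P P' hbot (fun φ hφ t g => hinv φ (hW₀W hφ) t g)
    (fun u πu hπu => hP u πu (hloc u πu.V πu.ρ hπu))
    (fun u πu hπu => hP' u πu (hlocτ u πu.V πu.ρ hπu))

end Main

/-! ### Part 3: corollaries for the named facts -/

/-- **`JacquetLanglands1970_standardLTheoryGL2` from `(an)` for clean `A_G`-invariant cuspidal
data.** [cite: JacquetLanglands1970, Thm. 11.1 and its proof, pp. 168–173] -/
theorem JacquetLanglands1970_standardLTheoryGL2_of_globalHeckeTheory_clean
    (H : ∀ {F : Type} [Field F] [NumberField F] (hcpt : isCompact_glFiniteIntegralLevel 2 F)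
      (π : CuspidalAutomorphicRepData 2 F hcpt) (P P' : HeightOneSpectrum (𝓞 F) → ℂ[X]),
      π.1.W' = ⊥ →
      (∀ φ ∈ π.1.W, ∀ (t : ℝ≥0ˣ) (g : (AdelicGroupData.gl 2 F).Adelic),
        φ ((show (AdelicGroupData.gl 2 F).Adelic from posRealScalar 2 F t) * g) = φ g) →
      (∀ (u : HeightOneSpectrum (𝓞 F)) (πu : SmoothIrrep (GL (Fin 2) (u.adicCompletion F))),
        π.1.HasLocalComponentAt u πu.ρ →
        ∀ (ψ : AddChar (u.adicCompletion F) Circle), ψ.IsContinuousNontrivial →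
        ∀ [MeasurableSpace (u.adicCompletion F)] [BorelSpace (u.adicCompletion F)]
          [MeasurableSpace (GL (Fin 1) (u.adicCompletion F) ⧸ upperUnitriangular (Fin 1) (u.adicCompletion F))]
          [BorelSpace (GL (Fin 1) (u.adicCompletion F) ⧸ upperUnitriangular (Fin 1) (u.adicCompletion F))]
          (ν : Measure (GL (Fin 1) (u.adicCompletion F) ⧸ upperUnitriangular (Fin 1) (u.adicCompletion F)))
          [SMulInvariantMeasure (GL (Fin 1) (u.adicCompletion F))
            (GL (Fin 1) (u.adicCompletion F) ⧸ upperUnitriangular (Fin 1) (u.adicCompletion F)) ν]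
          [IsFiniteMeasureOnCompacts ν] [ν.IsOpenPosMeasure],
          HasRSLFactor Nat.one_lt_two πu.ρ
            (Representation.trivial ℂ (GL (Fin 1) (u.adicCompletion F)) ℂ) ψ ν (P u)) →
      (∀ (u : HeightOneSpectrum (𝓞 F)) (πu : SmoothIrrep (GL (Fin 2) (u.adicCompletion F))),
        π.transposeInv.1.HasLocalComponentAt u πu.ρ →
        ∀ (ψ : AddChar (u.adicCompletion F) Circle), ψ.IsContinuousNontrivial →
        ∀ [MeasurableSpace (u.adicCompletion F)] [BorelSpace (u.adicCompletion F)]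
          [MeasurableSpace (GL (Fin 1) (u.adicCompletion F) ⧸ upperUnitriangular (Fin 1) (u.adicCompletion F))]
          [BorelSpace (GL (Fin 1) (u.adicCompletion F) ⧸ upperUnitriangular (Fin 1) (u.adicCompletion F))]
          (ν : Measure (GL (Fin 1) (u.adicCompletion F) ⧸ upperUnitriangular (Fin 1) (u.adicCompletion F)))
          [SMulInvariantMeasure (GL (Fin 1) (u.adicCompletion F))
            (GL (Fin 1) (u.adicCompletion F) ⧸ upperUnitriangular (Fin 1) (u.adicCompletion F)) ν]
          [IsFiniteMeasureOnCompacts ν] [ν.IsOpenPosMeasure],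
          HasRSLFactor Nat.one_lt_two πu.ρ
            (Representation.trivial ℂ (GL (Fin 1) (u.adicCompletion F)) ℂ) ψ ν (P' u)) →
      ∃ (Λ Λ' Γ Γ' ε : ℂ → ℂ) (c : ℝ),
        Meromorphic Λ ∧ Meromorphic Λ' ∧ Differentiable ℂ Γ ∧ Differentiable ℂ Γ' ∧
        (∃ Y : Set ℝ, Y.Finite ∧ ∀ s, Γ s = 0 → s.im ∈ Y) ∧
        (∃ Y : Set ℝ, Y.Finite ∧ ∀ s, Γ' s = 0 → s.im ∈ Y) ∧
        Continuous ε ∧ (∀ s, ε s ≠ 0) ∧ 1 ≤ c ∧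
        (∀ s : ℂ, c < s.re →
          (Multipliable fun u : HeightOneSpectrum (𝓞 F) =>
              ((P u).eval ((u.residueCard : ℂ) ^ (-s)))⁻¹) ∧
            (∀ u, (P u).eval ((u.residueCard : ℂ) ^ (-s)) ≠ 0) ∧
            Λ s * Γ s =
              ∏' u : HeightOneSpectrum (𝓞 F), ((P u).eval ((u.residueCard : ℂ) ^ (-s)))⁻¹) ∧
        (∀ s : ℂ, c < s.re →
          (Multipliable fun u : HeightOneSpectrum (𝓞 F) =>
              ((P' u).eval ((u.residueCard : ℂ) ^ (-s)))⁻¹) ∧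
            (∀ u, (P' u).eval ((u.residueCard : ℂ) ^ (-s)) ≠ 0) ∧
            Λ' s * Γ' s =
              ∏' u : HeightOneSpectrum (𝓞 F), ((P' u).eval ((u.residueCard : ℂ) ^ (-s)))⁻¹) ∧
        (∀ s, Λ s = ε s * Λ' (1 - s))) :
    JacquetLanglands1970_standardLTheoryGL2 := by
  refine JacquetLanglands1970_standardLTheoryGL2_of_globalHeckeTheory ?_
  intro F _ _ hcpt π P P' hP hP'
  exact globalHeckeTheoryGL2_an_of_clean H hcpt π P P' hP hP'

/-- **`JacquetLanglands1970_standardLTheoryGL2` from the integral-representation package `(IR)`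
of `StandardLTheoryGL2AnalyticAssembly` for clean `A_G`-invariant cuspidal data** (irreducible
invariant spaces of genuine cusp forms on `GL₂(F) A_G \ GL₂(𝔸_F)`, the setting of the tree's
`jpssIntegral`). [cite: JacquetLanglands1970, Thm. 11.1, Lemma 11.1.3, pp. 168–173] -/
theorem JacquetLanglands1970_standardLTheoryGL2_of_integralRepresentation_clean
    (hIR : ∀ {F : Type} [Field F] [NumberField F] (hcpt : isCompact_glFiniteIntegralLevel 2 F)
      (π : CuspidalAutomorphicRepData 2 F hcpt) (P P' : HeightOneSpectrum (𝓞 F) → ℂ[X]),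
      π.1.W' = ⊥ →
      (∀ φ ∈ π.1.W, ∀ (t : ℝ≥0ˣ) (g : (AdelicGroupData.gl 2 F).Adelic),
        φ ((show (AdelicGroupData.gl 2 F).Adelic from posRealScalar 2 F t) * g) = φ g) →
      (∀ (u : HeightOneSpectrum (𝓞 F)) (πu : SmoothIrrep (GL (Fin 2) (u.adicCompletion F))),
        π.1.HasLocalComponentAt u πu.ρ →
        ∀ (ψ : AddChar (u.adicCompletion F) Circle), ψ.IsContinuousNontrivial →
        ∀ [MeasurableSpace (u.adicCompletion F)] [BorelSpace (u.adicCompletion F)]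
          [MeasurableSpace (GL (Fin 1) (u.adicCompletion F) ⧸ upperUnitriangular (Fin 1) (u.adicCompletion F))]
          [BorelSpace (GL (Fin 1) (u.adicCompletion F) ⧸ upperUnitriangular (Fin 1) (u.adicCompletion F))]
          (ν : Measure (GL (Fin 1) (u.adicCompletion F) ⧸ upperUnitriangular (Fin 1) (u.adicCompletion F)))
          [SMulInvariantMeasure (GL (Fin 1) (u.adicCompletion F))
            (GL (Fin 1) (u.adicCompletion F) ⧸ upperUnitriangular (Fin 1) (u.adicCompletion F)) ν]
          [IsFiniteMeasureOnCompacts ν] [ν.IsOpenPosMeasure],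
          HasRSLFactor Nat.one_lt_two πu.ρ
            (Representation.trivial ℂ (GL (Fin 1) (u.adicCompletion F)) ℂ) ψ ν (P u)) →
      (∀ (u : HeightOneSpectrum (𝓞 F)) (πu : SmoothIrrep (GL (Fin 2) (u.adicCompletion F))),
        π.transposeInv.1.HasLocalComponentAt u πu.ρ →
        ∀ (ψ : AddChar (u.adicCompletion F) Circle), ψ.IsContinuousNontrivial →
        ∀ [MeasurableSpace (u.adicCompletion F)] [BorelSpace (u.adicCompletion F)]
          [MeasurableSpace (GL (Fin 1) (u.adicCompletion F) ⧸ upperUnitriangular (Fin 1) (u.adicCompletion F))]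
          [BorelSpace (GL (Fin 1) (u.adicCompletion F) ⧸ upperUnitriangular (Fin 1) (u.adicCompletion F))]
          (ν : Measure (GL (Fin 1) (u.adicCompletion F) ⧸ upperUnitriangular (Fin 1) (u.adicCompletion F)))
          [SMulInvariantMeasure (GL (Fin 1) (u.adicCompletion F))
            (GL (Fin 1) (u.adicCompletion F) ⧸ upperUnitriangular (Fin 1) (u.adicCompletion F)) ν]
          [IsFiniteMeasureOnCompacts ν] [ν.IsOpenPosMeasure],
          HasRSLFactor Nat.one_lt_two πu.ρ
            (Representation.trivial ℂ (GL (Fin 1) (u.adicCompletion F)) ℂ) ψ ν (P' u)) →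
      ∃ (c₀ : ℝ) (Z Z' J J' Γ Γ' η : ℂ → ℂ),
        Differentiable ℂ Z ∧ Differentiable ℂ Z' ∧ Differentiable ℂ J ∧ Differentiable ℂ J' ∧
        Differentiable ℂ Γ ∧ Differentiable ℂ Γ' ∧
        (∃ Y : Set ℝ, Y.Finite ∧ ∀ s, Γ s = 0 → s.im ∈ Y) ∧
        (∃ Y : Set ℝ, Y.Finite ∧ ∀ s, Γ' s = 0 → s.im ∈ Y) ∧
        (∀ s : ℂ, c₀ < s.re → J s ≠ 0 ∧ Z s * Γ s =
          J s * ∏' u : HeightOneSpectrum (𝓞 F), ((P u).eval ((u.residueCard : ℂ) ^ (-s)))⁻¹) ∧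
        (∀ s : ℂ, c₀ < s.re → J' s ≠ 0 ∧ Z' s * Γ' s =
          J' s * ∏' u : HeightOneSpectrum (𝓞 F), ((P' u).eval ((u.residueCard : ℂ) ^ (-s)))⁻¹) ∧
        (∀ s, Z s = Z' (1 - s)) ∧
        Continuous η ∧ (∀ s, η s ≠ 0) ∧ (∀ s, J' (1 - s) = η s * J s)) :
    JacquetLanglands1970_standardLTheoryGL2 := by
  refine JacquetLanglands1970_standardLTheoryGL2_of_globalHeckeTheory_clean ?_
  intro F _ _ hcpt π P P' hbot hinv hP hP'
  obtain ⟨c₀, Z, Z', J, J', Γ, Γ', η, hZ, hZ', hJ, hJ', hΓ, hΓ', hΓY, hΓ'Y, hE, hE', hFE, hη, hη0,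
    hJJ'⟩ := hIR hcpt π P P' hbot hinv hP hP'
  exact globalHeckeTheoryGL2_an_of_integralRepresentation π P P' hP hP' hZ hZ' hJ hJ' hΓ hΓ' hΓY
    hΓ'Y hE hE' hFE hη hη0 hJJ'

/-- **`JacquetLanglands1970_twistedHeckeTheoryGL2` from `(IR)` for clean `A_G`-invariant cuspidal
data.** [cite: JacquetLanglands1970, Thm. 11.1, Cor. 11.2, Prop. 11.3, pp. 168–176] -/
theorem JacquetLanglands1970_twistedHeckeTheoryGL2_of_integralRepresentation_clean
    (hIR : ∀ {F : Type} [Field F] [NumberField F] (hcpt : isCompact_glFiniteIntegralLevel 2 F)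
      (π : CuspidalAutomorphicRepData 2 F hcpt) (P P' : HeightOneSpectrum (𝓞 F) → ℂ[X]),
      π.1.W' = ⊥ →
      (∀ φ ∈ π.1.W, ∀ (t : ℝ≥0ˣ) (g : (AdelicGroupData.gl 2 F).Adelic),
        φ ((show (AdelicGroupData.gl 2 F).Adelic from posRealScalar 2 F t) * g) = φ g) →
      (∀ (u : HeightOneSpectrum (𝓞 F)) (πu : SmoothIrrep (GL (Fin 2) (u.adicCompletion F))),
        π.1.HasLocalComponentAt u πu.ρ →
        ∀ (ψ : AddChar (u.adicCompletion F) Circle), ψ.IsContinuousNontrivial →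
        ∀ [MeasurableSpace (u.adicCompletion F)] [BorelSpace (u.adicCompletion F)]
          [MeasurableSpace (GL (Fin 1) (u.adicCompletion F) ⧸ upperUnitriangular (Fin 1) (u.adicCompletion F))]
          [BorelSpace (GL (Fin 1) (u.adicCompletion F) ⧸ upperUnitriangular (Fin 1) (u.adicCompletion F))]
          (ν : Measure (GL (Fin 1) (u.adicCompletion F) ⧸ upperUnitriangular (Fin 1) (u.adicCompletion F)))
          [SMulInvariantMeasure (GL (Fin 1) (u.adicCompletion F))
            (GL (Fin 1) (u.adicCompletion F) ⧸ upperUnitriangular (Fin 1) (u.adicCompletion F)) ν]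
          [IsFiniteMeasureOnCompacts ν] [ν.IsOpenPosMeasure],
          HasRSLFactor Nat.one_lt_two πu.ρ
            (Representation.trivial ℂ (GL (Fin 1) (u.adicCompletion F)) ℂ) ψ ν (P u)) →
      (∀ (u : HeightOneSpectrum (𝓞 F)) (πu : SmoothIrrep (GL (Fin 2) (u.adicCompletion F))),
        π.transposeInv.1.HasLocalComponentAt u πu.ρ →
        ∀ (ψ : AddChar (u.adicCompletion F) Circle), ψ.IsContinuousNontrivial →
        ∀ [MeasurableSpace (u.adicCompletion F)] [BorelSpace (u.adicCompletion F)]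
          [MeasurableSpace (GL (Fin 1) (u.adicCompletion F) ⧸ upperUnitriangular (Fin 1) (u.adicCompletion F))]
          [BorelSpace (GL (Fin 1) (u.adicCompletion F) ⧸ upperUnitriangular (Fin 1) (u.adicCompletion F))]
          (ν : Measure (GL (Fin 1) (u.adicCompletion F) ⧸ upperUnitriangular (Fin 1) (u.adicCompletion F)))
          [SMulInvariantMeasure (GL (Fin 1) (u.adicCompletion F))
            (GL (Fin 1) (u.adicCompletion F) ⧸ upperUnitriangular (Fin 1) (u.adicCompletion F)) ν]
          [IsFiniteMeasureOnCompacts ν] [ν.IsOpenPosMeasure],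
          HasRSLFactor Nat.one_lt_two πu.ρ
            (Representation.trivial ℂ (GL (Fin 1) (u.adicCompletion F)) ℂ) ψ ν (P' u)) →
      ∃ (c₀ : ℝ) (Z Z' J J' Γ Γ' η : ℂ → ℂ),
        Differentiable ℂ Z ∧ Differentiable ℂ Z' ∧ Differentiable ℂ J ∧ Differentiable ℂ J' ∧
        Differentiable ℂ Γ ∧ Differentiable ℂ Γ' ∧
        (∃ Y : Set ℝ, Y.Finite ∧ ∀ s, Γ s = 0 → s.im ∈ Y) ∧
        (∃ Y : Set ℝ, Y.Finite ∧ ∀ s, Γ' s = 0 → s.im ∈ Y) ∧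
        (∀ s : ℂ, c₀ < s.re → J s ≠ 0 ∧ Z s * Γ s =
          J s * ∏' u : HeightOneSpectrum (𝓞 F), ((P u).eval ((u.residueCard : ℂ) ^ (-s)))⁻¹) ∧
        (∀ s : ℂ, c₀ < s.re → J' s ≠ 0 ∧ Z' s * Γ' s =
          J' s * ∏' u : HeightOneSpectrum (𝓞 F), ((P' u).eval ((u.residueCard : ℂ) ^ (-s)))⁻¹) ∧
        (∀ s, Z s = Z' (1 - s)) ∧
        Continuous η ∧ (∀ s, η s ≠ 0) ∧ (∀ s, J' (1 - s) = η s * J s)) :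
    JacquetLanglands1970_twistedHeckeTheoryGL2 :=
  JacquetLanglands1970_twistedHeckeTheoryGL2_of_JacquetLanglands1970_standardLTheoryGL2
    (JacquetLanglands1970_standardLTheoryGL2_of_integralRepresentation_clean hIR)

/-- **Gelbart's Prop. 4.1 at the `σ`-unramified places
(`frobSatakeCompatibleAt_of_isPiOfArtinRep_of_isUnramifiedAt`) from `(IR)` for clean
`A_G`-invariant cuspidal data.** [cite: Gelbart1997, Prop. 4.1]
[cite: JacquetLanglands1970, Thm. 11.1 and Thm. 12.2] -/
theorem frobSatakeCompatibleAt_of_isPiOfArtinRep_of_isUnramifiedAt_of_integralRepresentation_clean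
    (hIR : ∀ {F : Type} [Field F] [NumberField F] (hcpt : isCompact_glFiniteIntegralLevel 2 F)
      (π : CuspidalAutomorphicRepData 2 F hcpt) (P P' : HeightOneSpectrum (𝓞 F) → ℂ[X]),
      π.1.W' = ⊥ →
      (∀ φ ∈ π.1.W, ∀ (t : ℝ≥0ˣ) (g : (AdelicGroupData.gl 2 F).Adelic),
        φ ((show (AdelicGroupData.gl 2 F).Adelic from posRealScalar 2 F t) * g) = φ g) →
      (∀ (u : HeightOneSpectrum (𝓞 F)) (πu : SmoothIrrep (GL (Fin 2) (u.adicCompletion F))),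
        π.1.HasLocalComponentAt u πu.ρ →
        ∀ (ψ : AddChar (u.adicCompletion F) Circle), ψ.IsContinuousNontrivial →
        ∀ [MeasurableSpace (u.adicCompletion F)] [BorelSpace (u.adicCompletion F)]
          [MeasurableSpace (GL (Fin 1) (u.adicCompletion F) ⧸ upperUnitriangular (Fin 1) (u.adicCompletion F))]
          [BorelSpace (GL (Fin 1) (u.adicCompletion F) ⧸ upperUnitriangular (Fin 1) (u.adicCompletion F))]
          (ν : Measure (GL (Fin 1) (u.adicCompletion F) ⧸ upperUnitriangular (Fin 1) (u.adicCompletion F)))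
          [SMulInvariantMeasure (GL (Fin 1) (u.adicCompletion F))
            (GL (Fin 1) (u.adicCompletion F) ⧸ upperUnitriangular (Fin 1) (u.adicCompletion F)) ν]
          [IsFiniteMeasureOnCompacts ν] [ν.IsOpenPosMeasure],
          HasRSLFactor Nat.one_lt_two πu.ρ
            (Representation.trivial ℂ (GL (Fin 1) (u.adicCompletion F)) ℂ) ψ ν (P u)) →
      (∀ (u : HeightOneSpectrum (𝓞 F)) (πu : SmoothIrrep (GL (Fin 2) (u.adicCompletion F))),
        π.transposeInv.1.HasLocalComponentAt u πu.ρ →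
        ∀ (ψ : AddChar (u.adicCompletion F) Circle), ψ.IsContinuousNontrivial →
        ∀ [MeasurableSpace (u.adicCompletion F)] [BorelSpace (u.adicCompletion F)]
          [MeasurableSpace (GL (Fin 1) (u.adicCompletion F) ⧸ upperUnitriangular (Fin 1) (u.adicCompletion F))]
          [BorelSpace (GL (Fin 1) (u.adicCompletion F) ⧸ upperUnitriangular (Fin 1) (u.adicCompletion F))]
          (ν : Measure (GL (Fin 1) (u.adicCompletion F) ⧸ upperUnitriangular (Fin 1) (u.adicCompletion F)))
          [SMulInvariantMeasure (GL (Fin 1) (u.adicCompletion F))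
            (GL (Fin 1) (u.adicCompletion F) ⧸ upperUnitriangular (Fin 1) (u.adicCompletion F)) ν]
          [IsFiniteMeasureOnCompacts ν] [ν.IsOpenPosMeasure],
          HasRSLFactor Nat.one_lt_two πu.ρ
            (Representation.trivial ℂ (GL (Fin 1) (u.adicCompletion F)) ℂ) ψ ν (P' u)) →
      ∃ (c₀ : ℝ) (Z Z' J J' Γ Γ' η : ℂ → ℂ),
        Differentiable ℂ Z ∧ Differentiable ℂ Z' ∧ Differentiable ℂ J ∧ Differentiable ℂ J' ∧
        Differentiable ℂ Γ ∧ Differentiable ℂ Γ' ∧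
        (∃ Y : Set ℝ, Y.Finite ∧ ∀ s, Γ s = 0 → s.im ∈ Y) ∧
        (∃ Y : Set ℝ, Y.Finite ∧ ∀ s, Γ' s = 0 → s.im ∈ Y) ∧
        (∀ s : ℂ, c₀ < s.re → J s ≠ 0 ∧ Z s * Γ s =
          J s * ∏' u : HeightOneSpectrum (𝓞 F), ((P u).eval ((u.residueCard : ℂ) ^ (-s)))⁻¹) ∧
        (∀ s : ℂ, c₀ < s.re → J' s ≠ 0 ∧ Z' s * Γ' s =
          J' s * ∏' u : HeightOneSpectrum (𝓞 F), ((P' u).eval ((u.residueCard : ℂ) ^ (-s)))⁻¹) ∧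
        (∀ s, Z s = Z' (1 - s)) ∧
        Continuous η ∧ (∀ s, η s ≠ 0) ∧ (∀ s, J' (1 - s) = η s * J s)) :
    frobSatakeCompatibleAt_of_isPiOfArtinRep_of_isUnramifiedAt :=
  frobSatakeCompatibleAt_of_isPiOfArtinRep_of_isUnramifiedAt_of_JacquetLanglands1970_standardLTheoryGL2
    (JacquetLanglands1970_standardLTheoryGL2_of_integralRepresentation_clean hIR)

end Literature.NumberTheory.Automorphic

end
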